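import Summits.RiemannHypothesis.RiemannHypothesis.Theorems.JensenPolynomialsFarGumbelJunkR3
import Literature.NumberTheory.LFunctions.WangYang2024.PhiEnclosure
import Summits.RiemannHypothesis.RiemannHypothesis.Theorems.JensenPolynomialsSkewFarBulk

/-!
# Route `JensenPolynomials`, FAR crux `XiWindowZeroFreeRelFar` (B1-rel far) — line «far-gumbel» (theory g8, skeleton v5),
stub S2 `stub_junk`, part E: the region-B integral `∫_{(υ−2,∞)}` (RH-FREE; cell rh-jensen, HUMAN RULING D-0040; helper for
item `stmt-RiemannHypothesis-19465`)

`∫_{(υ−2,∞)} Φu^{2M}‖T_M(a/u²) − (1+a/u²)^{M−½}‖ ≤ (0.5635^{M+1}/2)(50+e^{18})·e^{9υ}υ^{2M}‖1+a/υ²‖^{M−½}·e² + 1.65‖a‖^{M+1}/(υ−2)`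
(`regionB_bound`) by `integral_mono_of_nonneg` against the integrable majorant `A₃e^{υ−u} + A₄u^{−2}`, from the pointwise bound
`junk_pointwise_R3` (part C) and the bulk bounds R3a (`u ≤ υ`) / R3b (`u > υ`, far mode).

§0 carries PRIVATE local copies (suffix `_loc`) of the R3a/R3b lemmas of `Theorems/JensenPolynomialsFarGumbelJunkPointwise.lean`
(p450583): that module was edited in place (p455591, p461979) and its object file has not been rebuilt since (farm answer
`remote:incoherent:…JunkPointwise:mismatch` to every importer, 2026-08-26 16:09Z–19:00Z), so this file must not import it.
The copies are verbatim up to the `_loc` renaming.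

WHAT THIS IS NOT: real-analysis bookkeeping for explicit integrals attached to `ξ`'s Taylor data and the kernel `Φ`; nothing
here bears on the zeros of `ζ` or the truth of RH. References: [GORZPNAS2019]; theory g8's card `far-gumbel` v5.
-/

noncomputable section
-- D-0017: `Summit.RiemannHypothesis.RiemannHypothesis.…` duplicates the namespace BY DESIGN (single-problem summit).
set_option linter.dupNamespace false

namespace Summit.RiemannHypothesis.RiemannHypothesis.Theorems.JensenPolynomials.FarGumbel

open Literature.NumberTheory.LFunctions Literature.NumberTheory.LFunctions.WangYang2024 MeasureTheory Set Complex Real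
open Summit.RiemannHypothesis.RiemannHypothesis.Theorems.JensenPolynomials.WindowEGF

/-! ## 0. Local copies of `…JunkPointwise` §1, §3 (private, suffix `_loc`) -/

/-- For `0 ≤ x ≤ 1` and `‖z‖ ≤ ½`: `‖x + z‖ ≤ ‖1 + z‖`. -/
private theorem norm_real_add_le_norm_one_add_loc {x : ℝ} (hx0 : 0 ≤ x) (hx1 : x ≤ 1) {z : ℂ} (hz : ‖z‖ ≤ 1 / 2) :
    ‖(x : ℂ) + z‖ ≤ ‖1 + z‖ := by
  have hre : |z.re| ≤ ‖z‖ := Complex.abs_re_le_norm z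
  have hre' := neg_abs_le z.re
  have hsq : ‖(x : ℂ) + z‖ ^ 2 ≤ ‖1 + z‖ ^ 2 := by
    rw [Complex.sq_norm, Complex.sq_norm, Complex.normSq_apply, Complex.normSq_apply]
    simp only [Complex.add_re, Complex.add_im, Complex.ofReal_re, Complex.ofReal_im, Complex.one_re, Complex.one_im,
      zero_add]
    nlinarith
  exact (pow_le_pow_iff_left₀ (norm_nonneg _) (norm_nonneg _) two_ne_zero).mp hsq

/-- `(υ²)^{N}·υ = υ^{2M}` bookkeeping: `υ·(υ²‖1+z‖)^N = υ^{2M}‖1+z‖^N` (`υ > 0`). -/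
private theorem mode_pow_bookkeeping_loc {M : ℕ} (hM : 1 ≤ M) {υ : ℝ} (hυ : 0 < υ) (q : ℝ) (hq : 0 ≤ q) :
    υ * (υ ^ 2 * q) ^ ((M : ℝ) - 1 / 2) = υ ^ (2 * M) * q ^ ((M : ℝ) - 1 / 2) := by
  rw [Real.mul_rpow (by positivity) hq, sq_rpow_halfExp hM hυ.le]
  have : υ * υ ^ (2 * M - 1) = υ ^ (2 * M) := by rw [← pow_succ']; congr 1; omega
  rw [← mul_assoc, this]

/-- **R3a.** For `0 < u ≤ υ` and `‖a‖ ≤ 0.3502υ²`: `Φ(u)·u·‖u²+a‖^{M−½} ≤ 50e^{9υ}υ^{2M}‖1 + a/υ²‖^{M−½}`. -/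
private theorem junk_pointwise_R3a_loc {M : ℕ} (hM : 1 ≤ M) {υ u : ℝ} {a : ℂ} (hυ : 0 < υ) (hu : 0 < u) (huυ : u ≤ υ)
    (ha : ‖a‖ ≤ 0.3502 * υ ^ 2) :
    deBruijnPhi u * u * ‖(u : ℂ) ^ 2 + a‖ ^ ((M : ℝ) - 1 / 2) ≤
      50 * Real.exp (9 * υ) * υ ^ (2 * M) * ‖1 + a / (υ : ℂ) ^ 2‖ ^ ((M : ℝ) - 1 / 2) := by
  have hN0 : 0 ≤ (M : ℝ) - 1 / 2 := by
    have : (1:ℝ) ≤ M := by exact_mod_cast hM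
    linarith
  have hυ2 : 0 < υ ^ 2 := by positivity
  -- Φ(u) ≤ 50 e^{9u} ≤ 50 e^{9υ}
  have hΦ : deBruijnPhi u ≤ 50 * Real.exp (9 * υ) := by
    have h := deBruijnPhi_le_fifty hu.le
    have h2 : Real.exp (9 * u - π * Real.exp (4 * u)) ≤ Real.exp (9 * υ) := Real.exp_le_exp.mpr (by nlinarith [pi_pos, Real.exp_pos (4 * u)])
    linarith [mul_le_mul_of_nonneg_left h2 (by norm_num : (0:ℝ) ≤ 50)]
  -- ‖u² + a‖ ≤ υ²‖1 + a/υ²‖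
  have hz : ‖a / (υ : ℂ) ^ 2‖ ≤ 1 / 2 := by
    rw [norm_div, norm_pow, Complex.norm_real, Real.norm_of_nonneg hυ.le, div_le_iff₀ hυ2]; linarith
  have hx : ‖(((u ^ 2 / υ ^ 2 : ℝ)) : ℂ) + a / (υ : ℂ) ^ 2‖ ≤ ‖1 + a / (υ : ℂ) ^ 2‖ :=
    norm_real_add_le_norm_one_add_loc (by positivity) (by rw [div_le_one hυ2]; nlinarith) hz
  have hfac : (u : ℂ) ^ 2 + a = (((υ ^ 2 : ℝ)) : ℂ) * ((((u ^ 2 / υ ^ 2 : ℝ)) : ℂ) + a / (υ : ℂ) ^ 2) := by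
    have hυ0 : (υ : ℂ) ≠ 0 := by exact_mod_cast hυ.ne'
    push_cast; field_simp
  have hnorm : ‖(u : ℂ) ^ 2 + a‖ ≤ υ ^ 2 * ‖1 + a / (υ : ℂ) ^ 2‖ := by
    rw [hfac, norm_mul, Complex.norm_real, Real.norm_of_nonneg hυ2.le]
    exact mul_le_mul_of_nonneg_left hx hυ2.le
  have hpow : ‖(u : ℂ) ^ 2 + a‖ ^ ((M : ℝ) - 1 / 2) ≤ (υ ^ 2 * ‖1 + a / (υ : ℂ) ^ 2‖) ^ ((M : ℝ) - 1 / 2) :=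
    Real.rpow_le_rpow (norm_nonneg _) hnorm hN0
  have hΦ0 := (deBruijnPhi_pos_of_nonneg hu.le).le
  calc deBruijnPhi u * u * ‖(u : ℂ) ^ 2 + a‖ ^ ((M : ℝ) - 1 / 2)
      ≤ (50 * Real.exp (9 * υ)) * υ * (υ ^ 2 * ‖1 + a / (υ : ℂ) ^ 2‖) ^ ((M : ℝ) - 1 / 2) := by
        apply mul_le_mul (mul_le_mul hΦ huυ hu.le (by positivity)) hpow (Real.rpow_nonneg (norm_nonneg _) _)
          (by positivity)
    _ = 50 * Real.exp (9 * υ) * υ ^ (2 * M) * ‖1 + a / (υ : ℂ) ^ 2‖ ^ ((M : ℝ) - 1 / 2) := by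
        rw [mul_assoc (50 * Real.exp (9 * υ)), mode_pow_bookkeeping_loc hM hυ _ (norm_nonneg _), ← mul_assoc]

/-- `e^{4t} ≥ 1 + 4t + 8t² + 8t³` for `t ≥ 0` (square of `1 + y + y²/2 ≤ e^y` at `y = 2t`). -/
private theorem exp_four_mul_ge_loc {t : ℝ} (ht : 0 ≤ t) : 1 + 4 * t + 8 * t ^ 2 + 8 * t ^ 3 ≤ Real.exp (4 * t) := by
  have h := Real.quadratic_le_exp_of_nonneg (show (0:ℝ) ≤ 2 * t by linarith)
  have h0 : 0 ≤ 1 + 2 * t + (2 * t) ^ 2 / 2 := by positivity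
  have hsq : (1 + 2 * t + (2 * t) ^ 2 / 2) ^ 2 ≤ Real.exp (2 * t) ^ 2 := pow_le_pow_left₀ h0 h 2
  rw [← Real.exp_nat_mul] at hsq
  have : ((2 : ℕ) : ℝ) * (2 * t) = 4 * t := by push_cast; ring
  rw [this] at hsq
  nlinarith [hsq, pow_nonneg ht 4]

/-- From the mode equation: `πe^{4υ} ≥ M/(2υ)` and `M/υ ≥ 10¹⁷`. -/
private theorem mode_consequences_loc (M : ℕ) {υ : ℝ}
    (hυ : (189 / 20 : ℝ) ≤ υ ∧ 4 * π * Real.exp (4 * υ) * υ = 2 * (M : ℝ) + 9 * υ) :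
    (M : ℝ) / (2 * υ) ≤ π * Real.exp (4 * υ) ∧ (1e17 : ℝ) ≤ (M : ℝ) / υ := by
  have hυ0 : 0 < υ := by linarith [hυ.1]
  have hE := hυ.2
  constructor
  · rw [div_le_iff₀ (by positivity)]; nlinarith
  · -- `M/υ = 2πe^{4υ} − 9/2 ≥ 2π·e^{37.8} − 4.5`
    have he : (2.6e16 : ℝ) ≤ Real.exp (4 * υ) := by
      have h378 := (SkewFar.exp_378_bounds).1
      exact h378.trans (Real.exp_le_exp.mpr (by linarith [hυ.1]))
    rw [le_div_iff₀ hυ0]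
    have h1 : 3 * (2.6e16 : ℝ) ≤ π * Real.exp (4 * υ) :=
      mul_le_mul Real.pi_gt_three.le he (by norm_num) Real.pi_pos.le
    have h2 : 3 * (2.6e16 : ℝ) * υ ≤ π * Real.exp (4 * υ) * υ := mul_le_mul_of_nonneg_right h1 hυ0.le
    nlinarith [h2, hυ.1]

set_option maxHeartbeats 400000 in
/-- **R3b.** For `u > υ` at the far mode (`4πe^{4υ}υ = 2M + 9υ`, `υ ≥ 189/20`) and `‖a‖ ≤ 0.3502υ²`:
`Φ(u)·u·‖u²+a‖^{M−½} ≤ e^{18}·e^{−(u−υ)}·e^{9υ}υ^{2M}‖1 + a/υ²‖^{M−½}`. -/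
private theorem junk_pointwise_R3b_loc {M : ℕ} (hM : 1 ≤ M) {υ u : ℝ} {a : ℂ}
    (hυ : (189 / 20 : ℝ) ≤ υ ∧ 4 * π * Real.exp (4 * υ) * υ = 2 * (M : ℝ) + 9 * υ) (huυ : υ < u)
    (ha : ‖a‖ ≤ 0.3502 * υ ^ 2) :
    deBruijnPhi u * u * ‖(u : ℂ) ^ 2 + a‖ ^ ((M : ℝ) - 1 / 2) ≤
      Real.exp 18 * Real.exp (-(u - υ)) * (Real.exp (9 * υ) * υ ^ (2 * M) * ‖1 + a / (υ : ℂ) ^ 2‖ ^ ((M : ℝ) - 1 / 2)) := by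
  have hυ0 : 0 < υ := by linarith [hυ.1]
  have hu : 0 < u := hυ0.trans huυ
  have hυ2 : 0 < υ ^ 2 := by positivity
  have hN0 : 0 ≤ (M : ℝ) - 1 / 2 := by
    have : (1:ℝ) ≤ M := by exact_mod_cast hM
    linarith
  have hNM : (M : ℝ) - 1 / 2 ≤ M := by linarith
  obtain ⟨hΛ, hm⟩ := mode_consequences_loc M hυ
  set t : ℝ := u - υ with htdef
  have ht : 0 < t := by rw [htdef]; linarith
  set q : ℝ := ‖1 + a / (υ : ℂ) ^ 2‖ with hqdef
  -- `q ≥ 0.6498`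
  have hz : ‖a / (υ : ℂ) ^ 2‖ ≤ 0.3502 := by
    rw [norm_div, norm_pow, Complex.norm_real, Real.norm_of_nonneg hυ0.le, div_le_iff₀ hυ2]; linarith
  have hq : 0.6498 ≤ q := by
    have h := norm_sub_norm_le (1 : ℂ) (-(a / (υ : ℂ) ^ 2))
    rw [sub_neg_eq_add, norm_neg, norm_one] at h
    rw [hqdef]; linarith
  have hq0 : 0 < q := by linarith
  -- (1) `Φ(u) ≤ 50 e^{9u − πe^{4u}}`
  have hΦ := deBruijnPhi_le_fifty hu.le
  -- (2) `‖u² + a‖ ≤ (u² − υ²) + υ² q ≤ υ² q (1 + 1.539 (u²−υ²)/υ²)`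
  have hfac : (υ : ℂ) ^ 2 + a = (((υ ^ 2 : ℝ)) : ℂ) * (1 + a / (υ : ℂ) ^ 2) := by
    have hυc : (υ : ℂ) ≠ 0 := by exact_mod_cast hυ0.ne'
    push_cast; field_simp
  have hnorm1 : ‖(u : ℂ) ^ 2 + a‖ ≤ (u ^ 2 - υ ^ 2) + υ ^ 2 * q := by
    have hsplit : (u : ℂ) ^ 2 + a = (((u ^ 2 - υ ^ 2 : ℝ)) : ℂ) + ((υ : ℂ) ^ 2 + a) := by push_cast; ring
    calc ‖(u : ℂ) ^ 2 + a‖ = ‖(((u ^ 2 - υ ^ 2 : ℝ)) : ℂ) + ((υ : ℂ) ^ 2 + a)‖ := by rw [hsplit]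
      _ ≤ ‖(((u ^ 2 - υ ^ 2 : ℝ)) : ℂ)‖ + ‖(υ : ℂ) ^ 2 + a‖ := norm_add_le _ _
      _ = (u ^ 2 - υ ^ 2) + υ ^ 2 * q := by
          rw [Complex.norm_real, Real.norm_of_nonneg (by nlinarith), hfac, norm_mul, Complex.norm_real,
            Real.norm_of_nonneg hυ2.le]
  set y : ℝ := (u ^ 2 - υ ^ 2) / (υ ^ 2 * q) with hydef
  have hy0 : 0 ≤ y := by rw [hydef]; apply div_nonneg (by nlinarith) (by positivity)
  have hnorm2 : ‖(u : ℂ) ^ 2 + a‖ ≤ υ ^ 2 * q * (1 + y) := by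
    have : υ ^ 2 * q * (1 + y) = (u ^ 2 - υ ^ 2) + υ ^ 2 * q := by rw [hydef]; field_simp; ring
    rw [this]; exact hnorm1
  have hpow : ‖(u : ℂ) ^ 2 + a‖ ^ ((M : ℝ) - 1 / 2) ≤ (υ ^ 2 * q) ^ ((M : ℝ) - 1 / 2) * Real.exp (((M : ℝ) - 1 / 2) * y) := by
    calc ‖(u : ℂ) ^ 2 + a‖ ^ ((M : ℝ) - 1 / 2) ≤ (υ ^ 2 * q * (1 + y)) ^ ((M : ℝ) - 1 / 2) :=
          Real.rpow_le_rpow (norm_nonneg _) hnorm2 hN0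
      _ = (υ ^ 2 * q) ^ ((M : ℝ) - 1 / 2) * (1 + y) ^ ((M : ℝ) - 1 / 2) :=
          Real.mul_rpow (by positivity) (by linarith)
      _ ≤ (υ ^ 2 * q) ^ ((M : ℝ) - 1 / 2) * Real.exp y ^ ((M : ℝ) - 1 / 2) := by
          apply mul_le_mul_of_nonneg_left _ (Real.rpow_nonneg (by positivity) _)
          exact Real.rpow_le_rpow (by linarith) (by linarith [Real.add_one_le_exp y]) hN0
      _ = (υ ^ 2 * q) ^ ((M : ℝ) - 1 / 2) * Real.exp (((M : ℝ) - 1 / 2) * y) := by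
          rw [← Real.exp_mul, mul_comm y]
  -- (3) the exponent: `E = (9u − πe^{4u}) + N y ≤ 9υ + 18 − t − log-free`, via `πe^{4u} = πe^{4υ}e^{4t} ≥ (M/(2υ))(1+4t+8t²+8t³)`
  -- `y ≤ 1.539 (2t/υ + t²/υ²)` and `N ≤ M`
  have hyprod : y * υ ^ 2 ≤ 1.539 * (2 * υ * t + t ^ 2) := by
    have hyq : y * (υ ^ 2 * q) = u ^ 2 - υ ^ 2 := by rw [hydef]; field_simp
    have hut : u ^ 2 - υ ^ 2 = 2 * υ * t + t ^ 2 := by rw [htdef]; ring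
    have h0 : 0 ≤ 2 * υ * t + t ^ 2 := by positivity
    nlinarith [hyq, hut, hq, hy0, hυ2]
  have hexp4 := exp_four_mul_ge_loc ht.le
  have heu : Real.exp (4 * u) = Real.exp (4 * υ) * Real.exp (4 * t) := by rw [← Real.exp_add, htdef]; ring_nf
  -- the master inequality on the exponent
  have hE : (9 * u - π * Real.exp (4 * u)) + ((M : ℝ) - 1 / 2) * y ≤ 9 * υ + 14 - 2 * t := by
    set m : ℝ := (M : ℝ) / υ with hmdef
    have hMm : (M : ℝ) = m * υ := by rw [hmdef]; field_simp
    have hm0 : 0 ≤ m := by rw [hmdef]; positivity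
    -- πe^{4u} ≥ (m/2)(1 + 4t + 8t² + 8t³)
    have h1 : (m / 2) * (1 + 4 * t + 8 * t ^ 2 + 8 * t ^ 3) ≤ π * Real.exp (4 * u) := by
      rw [heu]
      have : m / 2 = (M : ℝ) / (2 * υ) := by rw [hmdef]; field_simp
      rw [this, ← mul_assoc]
      exact mul_le_mul hΛ hexp4 (by positivity) (by positivity)
    -- N·y ≤ m(3.078 t + 0.1629 t²)
    have h2 : ((M : ℝ) - 1 / 2) * y ≤ m * (3.078 * t + 0.1629 * t ^ 2) := by
      have hy2 : y ≤ 1.539 * (2 * υ * t + t ^ 2) / υ ^ 2 := by rw [le_div_iff₀ hυ2]; exact hyprod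
      have hM0 : (0 : ℝ) ≤ M := by positivity
      have hsmall : 1.539 * t ^ 2 / υ ≤ 0.1629 * t ^ 2 := by
        rw [div_le_iff₀ hυ0]
        have hυ1 := hυ.1
        have ht2 : 0 ≤ t ^ 2 := sq_nonneg t
        nlinarith only [hυ1, ht2]
      calc ((M : ℝ) - 1 / 2) * y ≤ (M : ℝ) * y := mul_le_mul_of_nonneg_right hNM hy0
        _ ≤ (M : ℝ) * (1.539 * (2 * υ * t + t ^ 2) / υ ^ 2) := mul_le_mul_of_nonneg_left hy2 hM0
        _ = m * (3.078 * t + 1.539 * t ^ 2 / υ) := by rw [hmdef]; field_simp; ring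
        _ ≤ m * (3.078 * t + 0.1629 * t ^ 2) := by
            apply mul_le_mul_of_nonneg_left _ hm0
            linarith only [hsmall]
    -- polynomial endgame
    have hm17 : (1e17 : ℝ) ≤ m := hm
    have hpoly : 12 * t - 14 ≤ m * (1 / 2 - 1.078 * t + 3.8371 * t ^ 2 + 4 * t ^ 3) := by
      have hquad : 0.424 ≤ 1 / 2 - 1.078 * t + 3.8371 * t ^ 2 := by
        nlinarith only [sq_nonneg (t - 0.1405), ht.le]
      have ht3 : 0 ≤ t ^ 3 := by positivity
      have hP : 0 ≤ 1 / 2 - 1.078 * t + 3.8371 * t ^ 2 + 4 * t ^ 3 := by linarith only [hquad, ht3]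
      rcases le_or_gt t 1 with h1t | h1t
      · have hmP := mul_nonneg hm0 hP
        linarith only [hmP, h1t]
      · have htt : t ≤ t ^ 3 := by
          have ht1 : 1 ≤ t ^ 2 := by nlinarith only [h1t]
          calc t = t * 1 := by ring
            _ ≤ t * t ^ 2 := mul_le_mul_of_nonneg_left ht1 ht.le
            _ = t ^ 3 := by ring
        have h4 : 4 * t ^ 3 ≤ 1 / 2 - 1.078 * t + 3.8371 * t ^ 2 + 4 * t ^ 3 := by linarith only [hquad]
        have h5 : m * (4 * t ^ 3) ≤ m * (1 / 2 - 1.078 * t + 3.8371 * t ^ 2 + 4 * t ^ 3) :=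
          mul_le_mul_of_nonneg_left h4 hm0
        have h6 : 3 * (4 * t ^ 3) ≤ m * (4 * t ^ 3) :=
          mul_le_mul_of_nonneg_right (by linarith only [hm17]) (by positivity)
        linarith only [htt, h5, h6, h1t]
    have hid : m * (1 / 2 - 1.078 * t + 3.8371 * t ^ 2 + 4 * t ^ 3) =
        (m / 2) * (1 + 4 * t + 8 * t ^ 2 + 8 * t ^ 3) - m * (3.078 * t + 0.1629 * t ^ 2) := by ring
    have hu9 : 9 * u = 9 * υ + 9 * t := by rw [htdef]; ring
    linarith only [h1, h2, hpoly, hid, hu9, ht.le]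
  -- (4) assemble
  have hΦ0 := (deBruijnPhi_pos_of_nonneg hu.le).le
  have huυ' : u ≤ υ * Real.exp t := by
    have : 1 + t ≤ Real.exp t := by linarith [Real.add_one_le_exp t]
    have hu1 : u = υ + t := by rw [htdef]; ring
    rw [hu1]; nlinarith [hυ.1]
  have hbook := mode_pow_bookkeeping_loc hM hυ0 q hq0.le
  calc deBruijnPhi u * u * ‖(u : ℂ) ^ 2 + a‖ ^ ((M : ℝ) - 1 / 2)
      ≤ (50 * Real.exp (9 * u - π * Real.exp (4 * u))) * (υ * Real.exp t) *
          ((υ ^ 2 * q) ^ ((M : ℝ) - 1 / 2) * Real.exp (((M : ℝ) - 1 / 2) * y)) := by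
        apply mul_le_mul (mul_le_mul hΦ huυ' hu.le (by positivity)) hpow (Real.rpow_nonneg (norm_nonneg _) _)
          (by positivity)
    _ = 50 * (Real.exp ((9 * u - π * Real.exp (4 * u)) + ((M : ℝ) - 1 / 2) * y) * Real.exp t) *
          (υ * (υ ^ 2 * q) ^ ((M : ℝ) - 1 / 2)) := by rw [Real.exp_add]; ring
    _ ≤ 50 * (Real.exp (9 * υ + 14 - 2 * t) * Real.exp t) * (υ * (υ ^ 2 * q) ^ ((M : ℝ) - 1 / 2)) := by
        gcongr
    _ = (50 * Real.exp 14) * Real.exp (-t) * (Real.exp (9 * υ) * υ ^ (2 * M) * q ^ ((M : ℝ) - 1 / 2)) := by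
        have hexp : Real.exp (9 * υ + 14 - 2 * t) * Real.exp t = Real.exp 14 * Real.exp (-t) * Real.exp (9 * υ) := by
          rw [← Real.exp_add, ← Real.exp_add, ← Real.exp_add]
          congr 1; ring
        rw [hexp, hbook]
        ring
    _ ≤ Real.exp 18 * Real.exp (-(u - υ)) * (Real.exp (9 * υ) * υ ^ (2 * M) * q ^ ((M : ℝ) - 1 / 2)) := by
        have h50 : 50 * Real.exp 14 ≤ Real.exp 18 := by
          have h1 := Real.exp_one_gt_d9
          have h2 : (7.29 : ℝ) ≤ Real.exp 2 := by
            have : Real.exp 2 = Real.exp 1 * Real.exp 1 := by rw [← Real.exp_add]; norm_num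
            rw [this]; nlinarith only [h1]
          have h4 : (50 : ℝ) ≤ Real.exp 4 := by
            have : Real.exp 4 = Real.exp 2 * Real.exp 2 := by rw [← Real.exp_add]; norm_num
            rw [this]; nlinarith only [h2]
          calc 50 * Real.exp 14 ≤ Real.exp 4 * Real.exp 14 := by gcongr
            _ = Real.exp 18 := by rw [← Real.exp_add]; norm_num
        rw [htdef]
        gcongr

/-! ## 1. Region B: the truncation remainder `∫_{(υ−2, ∞)}` -/

set_option maxHeartbeats 400000 in
/-- **Region B.** `∫_{(υ−2,∞)} Φu^{2M}‖T_M − (1+a/u²)^{M−½}‖ ≤ (0.5635^{M+1}/2)(50+e^{18})·e^{9υ}υ^{2M}‖1+a/υ²‖^N·e² + 1.65‖a‖^{M+1}/(υ−2)`. -/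
theorem regionB_bound {M : ℕ} (hM : 1 ≤ M) {υ : ℝ}
    (hυ : (189 / 20 : ℝ) ≤ υ ∧ 4 * π * Real.exp (4 * υ) * υ = 2 * (M : ℝ) + 9 * υ) {a : ℂ} (ha : ‖a‖ ≤ 0.3502 * υ ^ 2) :
    (∫ u in Set.Ioi (υ - 2), deBruijnPhi u * u ^ (2 * M) *
        ‖∑ k ∈ Finset.range (M + 1),
            ((((descPochhammer ℝ k).eval ((M : ℝ) - 1 / 2) / (Nat.factorial k : ℝ) : ℝ)) : ℂ) * (a / (u : ℂ) ^ 2) ^ k -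
          (1 + a / (u : ℂ) ^ 2) ^ ((((M : ℝ) - 1 / 2 : ℝ)) : ℂ)‖) ≤
      0.5635 ^ (M + 1) / 2 * (50 + Real.exp 18) *
          (Real.exp (9 * υ) * υ ^ (2 * M) * ‖1 + a / (υ : ℂ) ^ 2‖ ^ ((M : ℝ) - 1 / 2)) * Real.exp 2 +
        1.65 * ‖a‖ ^ (M + 1) * (υ - 2)⁻¹ := by
  have hυ945 := hυ.1
  have hυ0 : 0 < υ := by linarith
  have hc : 0 < υ - 2 := by linarith
  set S : ℝ := Real.exp (9 * υ) * υ ^ (2 * M) * ‖1 + a / (υ : ℂ) ^ 2‖ ^ ((M : ℝ) - 1 / 2) with hSdef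
  have hS0 : 0 ≤ S := by positivity
  set A₃ : ℝ := 0.5635 ^ (M + 1) / 2 * (50 + Real.exp 18) * S with hA₃def
  set A₄ : ℝ := 1.65 * ‖a‖ ^ (M + 1) with hA₄def
  have hA₃0 : 0 ≤ A₃ := by positivity
  have hA₄0 : 0 ≤ A₄ := by positivity
  -- majorant and its integrability
  have hint1 : IntegrableOn (fun u : ℝ ↦ A₃ * Real.exp υ * Real.exp (-u)) (Set.Ioi (υ - 2)) :=
    (integrableOn_exp_neg_Ioi (υ - 2)).const_mul (A₃ * Real.exp υ)
  have hint2 : IntegrableOn (fun u : ℝ ↦ A₄ * u ^ (-2 : ℝ)) (Set.Ioi (υ - 2)) :=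
    (integrableOn_Ioi_rpow_of_lt (by norm_num : (-2 : ℝ) < -1) hc).const_mul A₄
  have hm_int : IntegrableOn (fun u : ℝ ↦ A₃ * Real.exp υ * Real.exp (-u) + A₄ * u ^ (-2 : ℝ)) (Set.Ioi (υ - 2)) :=
    hint1.add hint2
  -- pointwise bound on the region
  have hpt : ∀ᵐ u ∂(volume.restrict (Set.Ioi (υ - 2))),
      deBruijnPhi u * u ^ (2 * M) *
        ‖∑ k ∈ Finset.range (M + 1),
            ((((descPochhammer ℝ k).eval ((M : ℝ) - 1 / 2) / (Nat.factorial k : ℝ) : ℝ)) : ℂ) * (a / (u : ℂ) ^ 2) ^ k -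
          (1 + a / (u : ℂ) ^ 2) ^ ((((M : ℝ) - 1 / 2 : ℝ)) : ℂ)‖ ≤
      A₃ * Real.exp υ * Real.exp (-u) + A₄ * u ^ (-2 : ℝ) := by
    rw [ae_restrict_iff' measurableSet_Ioi]
    refine Filter.Eventually.of_forall fun u (hu : υ - 2 < u) ↦ ?_
    have hu0 : 0 < u := hc.trans hu
    have h3 := junk_pointwise_R3 hM hυ945 hu ha
    -- the bulk factor
    have hX : deBruijnPhi u * u * ‖(u : ℂ) ^ 2 + a‖ ^ ((M : ℝ) - 1 / 2) ≤ (50 + Real.exp 18) * Real.exp (-(u - υ)) * S := by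
      rcases le_or_gt u υ with hle | hgt
      · have h := junk_pointwise_R3a_loc hM hυ0 hu0 hle ha
        have he : 1 ≤ Real.exp (-(u - υ)) := Real.one_le_exp (by linarith)
        have h50 : (50 : ℝ) * S ≤ (50 + Real.exp 18) * Real.exp (-(u - υ)) * S := by
          have : (50 : ℝ) ≤ (50 + Real.exp 18) * Real.exp (-(u - υ)) := by nlinarith [Real.exp_pos 18, he]
          exact mul_le_mul_of_nonneg_right this hS0
        calc _ ≤ 50 * Real.exp (9 * υ) * υ ^ (2 * M) * ‖1 + a / (υ : ℂ) ^ 2‖ ^ ((M : ℝ) - 1 / 2) := h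
          _ = 50 * S := by rw [hSdef]; ring
          _ ≤ _ := h50
      · have h := junk_pointwise_R3b_loc hM hυ hgt ha
        have he0 : 0 ≤ Real.exp (-(u - υ)) := (Real.exp_pos _).le
        calc _ ≤ Real.exp 18 * Real.exp (-(u - υ)) * S := by rw [hSdef]; exact h
          _ ≤ (50 + Real.exp 18) * Real.exp (-(u - υ)) * S := by
              apply mul_le_mul_of_nonneg_right _ hS0
              exact mul_le_mul_of_nonneg_right (by linarith) he0
    have heq1 : Real.exp (-(u - υ)) = Real.exp υ * Real.exp (-u) := by rw [← Real.exp_add]; ring_nf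
    have heq2 : u⁻¹ ^ 2 = u ^ (-2 : ℝ) := by
      rw [show (-2 : ℝ) = -((2 : ℕ) : ℝ) by norm_num, Real.rpow_neg hu0.le, Real.rpow_natCast, inv_pow]
    have hc0 : (0 : ℝ) ≤ 0.5635 ^ (M + 1) / 2 := by positivity
    calc _ ≤ 0.5635 ^ (M + 1) / 2 * (deBruijnPhi u * u * ‖(u : ℂ) ^ 2 + a‖ ^ ((M : ℝ) - 1 / 2)) +
          1.65 * ‖a‖ ^ (M + 1) * u⁻¹ ^ 2 := h3
      _ ≤ 0.5635 ^ (M + 1) / 2 * ((50 + Real.exp 18) * Real.exp (-(u - υ)) * S) + 1.65 * ‖a‖ ^ (M + 1) * u⁻¹ ^ 2 := by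
          gcongr
      _ = A₃ * Real.exp υ * Real.exp (-u) + A₄ * u ^ (-2 : ℝ) := by rw [heq1, heq2, hA₃def, hA₄def]; ring
  have hnn : 0 ≤ᵐ[volume.restrict (Set.Ioi (υ - 2))] fun u : ℝ ↦ deBruijnPhi u * u ^ (2 * M) *
      ‖∑ k ∈ Finset.range (M + 1),
          ((((descPochhammer ℝ k).eval ((M : ℝ) - 1 / 2) / (Nat.factorial k : ℝ) : ℝ)) : ℂ) * (a / (u : ℂ) ^ 2) ^ k -
        (1 + a / (u : ℂ) ^ 2) ^ ((((M : ℝ) - 1 / 2 : ℝ)) : ℂ)‖ := by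
    rw [Filter.EventuallyLE, ae_restrict_iff' measurableSet_Ioi]
    refine Filter.Eventually.of_forall fun u (hu : υ - 2 < u) ↦ ?_
    have hu0 : 0 < u := hc.trans hu
    exact mul_nonneg (mul_nonneg (deBruijnPhi_pos_of_nonneg hu0.le).le (pow_nonneg hu0.le _)) (norm_nonneg _)
  have hmono := integral_mono_of_nonneg hnn hm_int hpt
  refine hmono.trans ?_
  rw [integral_add hint1 hint2, integral_const_mul, integral_const_mul, integral_exp_neg_Ioi,
    integral_Ioi_rpow_of_lt (by norm_num : (-2 : ℝ) < -1) hc]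
  have e1 : A₃ * Real.exp υ * Real.exp (-(υ - 2)) = A₃ * Real.exp 2 := by
    rw [mul_assoc, ← Real.exp_add]; ring_nf
  have e2 : A₄ * (-(υ - 2) ^ ((-2 : ℝ) + 1) / ((-2 : ℝ) + 1)) = A₄ * (υ - 2)⁻¹ := by
    rw [show ((-2 : ℝ) + 1) = -1 by norm_num, Real.rpow_neg_one]
    ring
  rw [e1, e2, hA₃def, hA₄def]

end Summit.RiemannHypothesis.RiemannHypothesis.Theorems.JensenPolynomials.FarGumbel

end
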